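import Summits.BirchSwinnertonDyer.BirchSwinnertonDyer.Theorems.KimAtThreeDeepLowerOffStratumLevelLoweringRibetRowsCE
import Summits.BirchSwinnertonDyer.BirchSwinnertonDyer.Theorems.KimAtThreeDeepLowerOffStratumLevelLoweringDoubleStabConditionOne
import Summits.BirchSwinnertonDyer.BirchSwinnertonDyer.Theorems.KimAtThreeDeepLowerOffStratumLevelLoweringStabIhara
import Summits.BirchSwinnertonDyer.BirchSwinnertonDyer.Theorems.KimAtThreeDeepLowerOffStratumLevelLoweringDoubleStabData
import HarnessLib

/-!
# Route `KimAtThreeKolyvagin` (rung W2), crux `DeepLowerAtThreeOffKatoStratum` (item 19679), registered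
# stub `stub_nonAdditive`, ROAD (b²) ASSEMBLED: the semistable depth-`1` rows with ONE EXTRA unramified prime `ℓ`,
# from the bare existence of the optimal-level newform (two-prime level lowering) — nothing else displayed

Cell `bsd-addord`, seat `bsd-addord-w2-acc2`, gen 5; item `stmt-BirchSwinnertonDyer-19679` (`--supports`, closes
nothing). Planner ROW CENSUS (STATUS ROUTING 2026-08-27T03:35:16Z + acc2 recount, folder `planner/r1census/`): of the
8 978 semistable depth-`1` rows failing the one-prime (R1) clauses, 8 107 have EXACTLY ONE further bad prime `ℓ ≠ q`
with `3 ∣ ord_ℓ Δ` (non-split multiplicative, or `ℓ = 3`). For them Ribet/Diamond lower the level to the optimal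
`M₀ = N/(qℓ)`, and the comparison form for Vatsal's congruence is the DOUBLE stabilisation
`h = ι₁ G − β ι_q G`, `G = ι₁ g − β′ ι_ℓ g`, with `β ≡ q` (`q` split) and `β′ ≡ uℓ`, `u = a_ℓ(E) = ±1`. THIS FILE
assembles ROAD (b²) = ROAD (b) with the pieces of files P1–P4a (`…StabEigenform`, `…DoubleStabConditionOne`,
`…StabCanonicalPeriod`, `…StabIhara`, `…DoubleStabData`):

★★★★ `stub_nonAdditive_semistable_twoPrimes_of_exists_levelLoweredNewform` — the registered stub's binders VERBATIM
(level written `M₀·ℓ·q`) + `Semistable W₀` + «ordinary if good at `3`» + `v₃(∏ c_ℓ) ≤ 1` + `q` split multiplicative,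
`q ∤ M₀ℓ`, `ℓ ∤ M₀`, `M₀ℓ` squarefree, `a_ℓ(D₀.f) = u` with `u² = 1` + the EXISTENCE (for every `ι`) of a newform
`g ∈ S₂(Γ₀(M₀))` with `a_p(g) ≡ a_p(D₀.f)` (`p ∉ {q, ℓ}`), `a_q(g) ≡ q + 1`, `a_ℓ(g) ≡ u(ℓ + 1)` ⟹ the LOWER deep
inequality of 19679, from ELEVEN NAMED FACTS (`colemanEdixhoven1998_heckePolynomial_simpleRoots` for `α ≠ β`,
`α′ ≠ β′`). The existence clause is Diamond 1995 Thm. 6.4 / Cor. 6.5 + Ribet 1990 Thm. 1.1 + Carayol at the optimal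
level `N(ρ̄) = M₀` (the two-prime twin of `ribet1990_levelLowering_gamma0_newform_at_three`; to be typed in
`Literature/…/LevelLoweringGamma0AtThree.lean`'s currency) — DISPLAYED here as a hypothesis, not asserted.
Theorems only; nothing booked; BSD is not proved by any of this.
-/

set_option autoImplicit false
-- the Theorems namespace of a single-conjunct summit repeats the summit name by design (D-0017)
set_option linter.dupNamespace false

noncomputable section

open scoped MatrixGroups ModularForm Classical NNReal

open CongruenceSubgroup WeierstrassCurve Literature.NumberTheory.EllipticCurves
  Literature.NumberTheory.EllipticCurves.ModularForms

namespace Summit.BirchSwinnertonDyer.BirchSwinnertonDyer.Theorems.KimAtThreeDeepLowerOffStratumLevelLoweringDoubleStabRows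

open Summit.BirchSwinnertonDyer.BirchSwinnertonDyer.Theorems.KimAtThreeDeepLowerOffStratumLevelLoweringVatsal
open Summit.BirchSwinnertonDyer.BirchSwinnertonDyer.Theorems.KimAtThreeDeepLowerOffStratumLevelLoweringVatsalRows
open Summit.BirchSwinnertonDyer.BirchSwinnertonDyer.Theorems.KimAtThreeDeepLowerOffStratumLevelLoweringVatsalStab
open Summit.BirchSwinnertonDyer.BirchSwinnertonDyer.Theorems.KimAtThreeDeepLowerOffStratumLevelLoweringVatsalStabRows
open Summit.BirchSwinnertonDyer.BirchSwinnertonDyer.Theorems.KimAtThreeDeepLowerOffStratumLevelLoweringRekey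
open Summit.BirchSwinnertonDyer.BirchSwinnertonDyer.Theorems.KimAtThreeDeepLowerOffStratumLevelLoweringConditionOne
open Summit.BirchSwinnertonDyer.BirchSwinnertonDyer.Theorems.KimAtThreeDeepLowerOffStratumLevelLoweringNonEisensteinPrime
open Summit.BirchSwinnertonDyer.BirchSwinnertonDyer.Theorems.KimAtThreeDeepLowerOffStratumLevelLoweringRibetRows
open Summit.BirchSwinnertonDyer.BirchSwinnertonDyer.Theorems.KimAtThreeDeepLowerOffStratumLevelLoweringStabEigenform
  renaming heckeT_stab_of_ne → heckeT_stab_of_ne_eig, heckeT_stab_self → heckeT_stab_self_eig,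
    isHeckeEigenform_stab → isHeckeEigenform_stab_eig, cuspCoeff_stab_prime → cuspCoeff_stab_prime_eig,
    cuspCoeff_mul_cuspCoeff → cuspCoeff_mul_cuspCoeff_eig, heckeEigenvalue_stab → heckeEigenvalue_stab_eig,
    valuation_cuspCoeff_stab_le_one → valuation_cuspCoeff_stab_le_one_eig,
    finiteDimensional_coeffField_stab → finiteDimensional_coeffField_stab_eig
open Summit.BirchSwinnertonDyer.BirchSwinnertonDyer.Theorems.KimAtThreeDeepLowerOffStratumLevelLoweringStabEigenform (smul_plusSymbol_of_heckeT)
open Summit.BirchSwinnertonDyer.BirchSwinnertonDyer.Theorems.KimAtThreeDeepLowerOffStratumLevelLoweringDoubleStabConditionOne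
open Summit.BirchSwinnertonDyer.BirchSwinnertonDyer.Theorems.KimAtThreeDeepLowerOffStratumLevelLoweringStabCanonicalPeriod
open Summit.BirchSwinnertonDyer.BirchSwinnertonDyer.Theorems.KimAtThreeDeepLowerOffStratumLevelLoweringStabIhara
open Summit.BirchSwinnertonDyer.BirchSwinnertonDyer.Theorems.KimAtThreeDeepLowerOffStratumLevelLoweringDoubleStabData
open Literature.NumberTheory.EllipticCurves.Rank1Residual Literature.NumberTheory.EllipticCurves.Rank1Residual.Typed
  Literature.NumberTheory.EllipticCurves.Skinner2016 Literature.NumberTheory.Automorphic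

/-- ★★★★ **`stub_nonAdditive` (crux 19679) on its SEMISTABLE depth-`1` rows with ONE EXTRA unramified prime `ℓ`,
from ELEVEN NAMED FACTS + the row conditions + the EXISTENCE of the optimal-level newform** (two-prime level
lowering, displayed). Inside: roots `β ≡ q`, `β′ ≡ uℓ` (`…DoubleStabData`, `…ConditionOne`); `α ≠ β`, `α′ ≠ β′`
(Coleman–Edixhoven); the double stabilisation `h` is a normalised eigenform at level `N` congruent to `D₀.f` in
ALL coefficients (`…StabEigenform`, `valuation_cuspCoeff_sub_lt_one_of_prime`); Condition 1 for `h`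
(`…DoubleStabConditionOne`); the numeral `r₀ ≡ 1 (mod N)` by Chebotarev (`…NonEisensteinPrime`); Vatsal's
congruence BY NAME with the period produced afterwards (`…DoubleStabData` §2): `Ψ = plusSymbol G ≢ 0`, the
canonical period of `Ψ` (`…StabCanonicalPeriod`), Ihara for `G` (`…StabIhara`); THEOREM A; gen 2's rekey consumer.
[cite: Vatsal1999, §1 (1.6), Thm. (1.13)] [cite: GreenbergVatsal2000, §3 (17)–(19)] [cite: Ribet1984ICM, Thm. 4.1]
[cite: ColemanEdixhoven1998, Thm. 2.1] [cite: TateGCFT1967, §2.4 (Tchebotarev density theorem) with Prop. 2.3]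
[cite: Skinner2016PacificMC, Thm. C (§1)] [cite: Mazur1978, Cor. 4.1] [cite: Kim2022StructureSelmer, Conj. 1.10 (PDF p. 8)] -/
theorem stub_nonAdditive_semistable_twoPrimes_of_exists_levelLoweredNewform
    (hCE : colemanEdixhoven1998_heckePolynomial_simpleRoots)
    (hV : vatsal1999_plusSymbol_congruence) (hGV : greenbergVatsal2000_plusSymbol_congruence)
    (hI : ribet1984_iharaLemma)
    (hSk : Skinner2016.thmC_padicValRat_bsd_rank_zero)
    (hmod : hasEntireLFunction_rat) (hGZK : rank_eq_analyticRank_of_analyticRank_le_one)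
    (hM : mazur_not_dvd_maninConstant_of_odd)
    (hBCDT : exists_isNewformOf) (hLL' : diamond1995_refinedSerre) :
    ∀ (W₀ : WeierstrassCurve ℚ) [W₀.IsElliptic] [W₀.IsGloballyMinimal],
      (∀ n : ℕ, W₀.HasSurjectiveModNGaloisRep (3 ^ n : ℕ)) → Finite W₀.sha →
      ∀ {M₀ ℓ q : ℕ} [NeZero M₀] [NeZero ℓ] [Fact ℓ.Prime] [NeZero q] [Fact q.Prime] [NeZero (M₀ * ℓ)]
        [NeZero (M₀ * ℓ * q)], M₀ * ℓ * q = W₀.conductorNorm ℤ →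
      ∀ (D₀ : ModularParametrizationData W₀ (M₀ * ℓ * q)),
        (∀ z ∈ D₀.L.lattice, ∃ w ∈ periodLattice D₀.f, z = D₀.c * w) →
        (∀ (W₂ : WeierstrassCurve ℚ) [W₂.IsElliptic] (D₂ : ModularParametrizationData W₂ (M₀ * ℓ * q)),
          D₂.f = D₀.f → D₀.modularDegree ≤ D₂.modularDegree) →
        (∀ r : ℚ, ratPlusSymbol D₀.f r ≠ 0 → 0 ≤ padicValRat 3 (ratPlusSymbol D₀.f r)) →
        kuriharaVanishingOrder W₀ 3 D₀.f = 0 →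
        ¬ (haveI : Fact (Nat.Prime 3) := ⟨Nat.prime_three⟩; Addv W₀ 3) →
        Semistable W₀ →
        (W₀.HasGoodReductionAtPrime 3 → ¬ (3 : ℤ) ∣ W₀.frobeniusTrace 3) →
        padicValNat 3 W₀.tamagawaProduct ≤ 1 →
        W₀.HasSplitMultiplicativeReductionAtPrime q → ¬ q ∣ M₀ * ℓ → ¬ ℓ ∣ M₀ → Squarefree (M₀ * ℓ) →
        ∀ {u : ℤ}, u * u = 1 → cuspCoeff D₀.f ℓ = u →
        (∀ ι : PadicAlgCl 3 ≃+* ℂ, ∃ g : CuspForm (Gamma0 M₀) 2, IsNewform0 g ∧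
          (∀ p : ℕ, p.Prime → p ≠ q → p ≠ ℓ → Valued.v (ι.symm (cuspCoeff D₀.f p - cuspCoeff g p)) < 1) ∧
          Valued.v (ι.symm (cuspCoeff g q - (q + 1))) < 1 ∧
          Valued.v (ι.symm (cuspCoeff g ℓ - u * (ℓ + 1))) < 1) →
        ∃ d : ℕ, kuriharaPartialDeepInfty W₀ 3 D₀.f = d ∧
          kuriharaPartial W₀ 3 D₀.f 0 ≤
            ((padicValNat 3 (Nat.card (AddCommGroup.primaryComponent W₀.sha 3)) + d : ℕ) : ℕ∞) := by
  intro W₀ _ _ htower hfin M₀ ℓ q _ _ _ _ _ _ _ hN D₀ hopt hdeg hint hord hnA hsst hordinary hv hsplit hqM hℓM hMsq u hu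
    hfℓ hex
  have hq : q.Prime := Fact.out
  have hℓ : ℓ.Prime := Fact.out
  have hqℓ : q ≠ ℓ := by rintro rfl; exact hqM (dvd_mul_left q M₀)
  have hqM₀ : ¬ q ∣ M₀ := fun h ↦ hqM (h.mul_right ℓ)
  set ι : PadicAlgCl 3 ≃+* ℂ := Classical.choice (PadicAlgCl.nonempty_ringEquiv_complex 3) with hι
  obtain ⟨g, hg, hcp, haq, haℓ⟩ := hex ι
  have hf := D₀.isNewformOf
  -- the roots `β′ ≡ uℓ` (at `ℓ`) and `β ≡ q` (at `q`), both pairs distinct (Coleman–Edixhoven)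
  obtain ⟨β', hβ', -, hα'⟩ := exists_root_valuation_sub_lt_one_sign ι (valuation_cuspCoeff_le_one_of_isNewform0 hg ι ℓ) ℓ hu haℓ
  obtain ⟨β, hβ, hβq⟩ := exists_root_valuation_sub_lt_one ι (valuation_cuspCoeff_le_one_of_isNewform0 hg ι q) q haq
  have hne' : cuspCoeff g ℓ - β' ≠ β' :=
    colemanEdixhoven1998_heckePolynomial_simpleRoots.root_ne hCE hg hℓ hℓM (sub_add_cancel _ β') (by linear_combination -hβ')
  have hne : cuspCoeff g q - β ≠ β :=
    colemanEdixhoven1998_heckePolynomial_simpleRoots.root_ne hCE hg hq hqM₀ (sub_add_cancel _ β) (by linear_combination -hβ)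
  obtain ⟨hα1, hc⟩ := valuation_div_sub_one_lt_one ι hq hβ haq hβq
  -- levels and the two stabilisations
  have h1 : M₀ * 1 ∣ M₀ * ℓ := mul_dvd_mul_left M₀ (one_dvd ℓ)
  have hℓℓ : M₀ * ℓ ∣ M₀ * ℓ := dvd_rfl
  have hq₁ : M₀ * ℓ * 1 ∣ M₀ * ℓ * q := mul_dvd_mul_left _ (one_dvd q)
  have hqq : M₀ * ℓ * q ∣ M₀ * ℓ * q := dvd_rfl
  set G := iota M₀ (M₀ * ℓ) 1 2 h1 g - β' • iota M₀ (M₀ * ℓ) ℓ 2 hℓℓ g with hGdef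
  set h := iota (M₀ * ℓ) (M₀ * ℓ * q) 1 2 hq₁ G - β • iota (M₀ * ℓ) (M₀ * ℓ * q) q 2 hqq G with hhdef
  -- data of `G`
  have hGeig : IsHeckeEigenform G := isHeckeEigenform_stab hg β' h1 hℓℓ hℓ hℓM hβ'
  have hGnorm : IsNormalized G := isNormalized_stab g β' h1 hℓℓ hg.2.2 hℓ
  have hGint : ∀ n, Valued.v (ι.symm (cuspCoeff G n)) ≤ 1 := valuation_cuspCoeff_stab_le_one hg ι β' h1 hℓℓ hβ'
  have hGfd : FiniteDimensional ℚ (coeffField G) := finiteDimensional_coeffField_stab hg β' h1 hℓℓ hβ'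
  have hGp : ∀ {p : ℕ}, p.Prime → cuspCoeff G p = if p = ℓ then cuspCoeff g ℓ - β' else cuspCoeff g p :=
    fun hp ↦ cuspCoeff_stab_prime hg β' h1 hℓℓ hℓ hp
  have hGq : cuspCoeff G q = cuspCoeff g q := by rw [hGp hq, if_neg hqℓ]
  have hβG : β ^ 2 - cuspCoeff G q * β + q = 0 := by rw [hGq]; exact hβ
  -- data of `h`
  have heig : IsHeckeEigenform h := isHeckeEigenform_stab_eig hGeig hGnorm β hq₁ hqq hq hqM hβG
  have hnorm : IsNormalized h := isNormalized_stab G β hq₁ hqq hGnorm hq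
  have hhint : ∀ n, Valued.v (ι.symm (cuspCoeff h n)) ≤ 1 := valuation_cuspCoeff_stab_le_one_eig ι β hq₁ hqq hGint hβG
  have hhfd : FiniteDimensional ℚ (coeffField h) := finiteDimensional_coeffField_stab_eig β hq₁ hqq hGfd hβG
  have hhC : HasSimpleHeckeGenEigenspace h :=
    hasSimpleHeckeGenEigenspace_doubleStab_of_ne hg h1 hℓℓ hq₁ hqq hℓ hℓM hq hqM hβ' hβ hne' hne
  have hfC : HasSimpleHeckeGenEigenspace D₀.f := hasSimpleHeckeGenEigenspace_of_isNewform0 hf.1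
  -- congruence of ALL coefficients, from the primes
  have hfq : cuspCoeff D₀.f q = 1 := by
    rw [hf.2 q, lFunction_eq_one_of_hasSplitMultiplicativeReductionAtPrime W₀ q hsplit, Int.cast_one]
  have hcong : ∀ n : ℕ, Valued.v (ι.symm (cuspCoeff D₀.f n - cuspCoeff h n)) < 1 := by
    refine valuation_cuspCoeff_sub_lt_one_of_prime ι hf.1.2.1 heig hf.1.2.2 hnorm
      (valuation_cuspCoeff_le_one_of_isNewformOf W₀ hf ι) hhint fun p hp ↦ ?_
    rw [hhdef, cuspCoeff_stab_prime_eig hGnorm β hq₁ hqq hq hp]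
    by_cases hpq : p = q
    · subst hpq
      rw [if_pos rfl, hGq, hfq]
      have : ι.symm (1 - (cuspCoeff g p - β)) = -ι.symm (cuspCoeff g p - β - 1) := by rw [← map_neg]; congr 1; ring
      rw [this, Valuation.map_neg]; exact hα1
    · rw [if_neg hpq, hGp hp]
      by_cases hpℓ : p = ℓ
      · subst hpℓ
        rw [if_pos rfl, hfℓ]
        have : ι.symm ((u : ℂ) - (cuspCoeff g p - β')) = -ι.symm (cuspCoeff g p - β' - u) := by
          rw [← map_neg]; congr 1; ring
        rw [this, Valuation.map_neg]; exact hα'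
      · rw [if_neg hpℓ]; exact hcp p hp hpq hpℓ
  -- the OLD SHAPE data `(Φ, c, b) = (plusSymbol G, β/q, a_·(g))`
  have hshape : ∀ x : ℚ, plusSymbol h x = plusSymbol G x - β / q * plusSymbol G (q * x) :=
    fun x ↦ plusSymbol_stab G β hq₁ hqq x
  have hΦper : ∀ x : ℚ, plusSymbol G (x + 1) = plusSymbol G x := by
    intro x
    have e₁ := modularSymbol_add_intCast_holds G x 1
    have e₂ := modularSymbol_add_intCast_holds G (-x) (-1)
    simp only [plusSymbol]
    rw [show -(x + 1) = -x + ((-1 : ℤ) : ℚ) by push_cast; ring, e₂, show x + 1 = x + ((1 : ℤ) : ℚ) by push_cast; ring, e₁]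
  have hb : ∀ p : ℕ, p.Prime → ¬ p ∣ W₀.conductorNorm ℤ * 3 →
      Valued.v (ι.symm (cuspCoeff g p - (W₀.frobeniusTrace p : ℂ))) < 1 := by
    intro p hp hpN3
    haveI : Fact p.Prime := ⟨hp⟩
    have hpN : ¬ p ∣ W₀.conductorNorm ℤ := fun h' ↦ hpN3 (h'.mul_right 3)
    have hpq : p ≠ q := by rintro rfl; exact hpN (hN ▸ dvd_mul_left p _)
    have hpℓ : p ≠ ℓ := by rintro rfl; exact hpN (hN ▸ (dvd_mul_left p M₀).mul_right q)
    have hfp : cuspCoeff D₀.f p = (W₀.frobeniusTrace p : ℂ) := by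
      rw [hf.2 p, LFunction_apply_prime_eq_frobeniusTrace W₀ p (hasGoodReductionAtPrime_of_not_dvd_conductorNorm W₀ hpN)]
    rw [← hfp, ← Valuation.map_neg, ← map_neg, neg_sub]
    exact hcp p hp hpq hpℓ
  have hΦhecke : ∀ p : ℕ, p.Prime → ¬ p ∣ W₀.conductorNorm ℤ * 3 → ∀ x : ℚ,
      cuspCoeff g p * plusSymbol G x = (∑ j : Fin p, plusSymbol G ((x + j) / p)) + plusSymbol G (p * x) := by
    intro p hp hpN3 x
    haveI : NeZero p := ⟨hp.ne_zero⟩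
    have hpM : ¬ p ∣ M₀ * ℓ := fun h' ↦ hpN3 ((hN ▸ h'.mul_right q).mul_right 3)
    have hpℓ : p ≠ ℓ := by rintro rfl; exact hpM (dvd_mul_left p M₀)
    exact smul_plusSymbol_of_heckeT p hp hpM (heckeT_stab_of_ne hg β' h1 hℓℓ hℓ hp hpℓ) x
  -- the numeral `r₀ ≡ 1 (mod N)` by Chebotarev, and the unit `a_{r₀}(g) − r₀ − 1`
  have hsurj : W₀.HasSurjectiveModNGaloisRep ((3 : ℕ) : ℤ) := by simpa only [pow_one] using htower 1
  obtain ⟨r₀, hr₀, -, hr₀S, -, hr₀1, hE₀⟩ := exists_prime_one_mod_not_dvd_frobeniusTrace_sub W₀ hsurj (M₀ * ℓ * q)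
  haveI : Fact r₀.Prime := ⟨hr₀⟩
  have hr₀q : r₀ ≠ q := by rintro rfl; exact hr₀S (dvd_mul_left r₀ _)
  have hr₀M : ¬ r₀ ∣ M₀ * ℓ := fun h' ↦ hr₀S (h'.mul_right q)
  have hr₀ℓ : r₀ ≠ ℓ := by rintro rfl; exact hr₀M (dvd_mul_left r₀ M₀)
  have hr₀N : ¬ r₀ ∣ W₀.conductorNorm ℤ := by rwa [← hN]
  have hfr₀ : cuspCoeff D₀.f r₀ = (W₀.frobeniusTrace r₀ : ℂ) := by
    rw [hf.2 r₀, LFunction_apply_prime_eq_frobeniusTrace W₀ r₀ (hasGoodReductionAtPrime_of_not_dvd_conductorNorm W₀ hr₀N)]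
  have hunit : Valued.v (ι.symm (cuspCoeff g r₀ - (r₀ + 1))) = 1 := by
    refine valuation_cuspCoeff_sub_eq_one_of_congr ι hE₀ ?_
    rw [← hfr₀]; exact hcp r₀ hr₀ hr₀q hr₀ℓ
  -- the period producer: `plusSymbol h ≢ 0 ⟹ Ψ ≢ 0 ⟹ Ω (canonical period of Ψ) ⟹ x₀ (Ihara)`
  have hΩ : (∃ x : ℚ, plusSymbol h x ≠ 0) →
      ∃ Ω : ℂ, (∀ x : ℚ, Valued.v (ι.symm (plusSymbol G x / Ω)) ≤ 1) ∧
        ∃ x₀ : ℚ, Valued.v (ι.symm ((plusSymbol G x₀ - β / q * plusSymbol G (q * x₀)) / Ω)) = 1 := by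
    rintro ⟨x, hx⟩
    have hne0 : ∃ y : ℚ, plusSymbol G y ≠ 0 := by
      by_contra hall
      push Not at hall
      exact hx (by rw [hshape, hall, hall, mul_zero, sub_zero])
    obtain ⟨Ω, hΩint, γ₀, hγ₀, hΩu⟩ := exists_period_integral_unit_cycle_stab (t := β') h1 hℓℓ ι hMsq hg hℓ hne0 hr₀ hr₀M hunit
    obtain ⟨x₀, hx₀⟩ := exists_valuation_stabilisedSymbol_eq_one_stab_of_ribet1984_iharaLemma h1 hℓℓ hI hq hqM hg β' ι
      hΩint γ₀ hγ₀ hΩu hr₀ hr₀S hr₀1 hunit hc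
    exact ⟨Ω, hΩint, x₀, hx₀⟩
  -- THEOREM A (with producer), then gen 2's rekey consumer
  obtain ⟨π, hLL⟩ := isStabilisedLevelLoweringCongruenceIn_three_of_not_addv_of_exists_period hV hGV W₀ htower hN D₀
    hint hnA ι h q hfC heig hnorm hhfd hhint hhC hcong (plusSymbol G) (β / q) (fun p ↦ cuspCoeff g p) hshape hc hΦper hb
    hΦhecke hΩ
  exact stub_nonAdditive_semistable_of_isStabilisedLevelLoweringCongruenceIn hSk hmod hGZK hM hBCDT hLL' W₀ htower hfin
    hN D₀ hopt hdeg hint hord hnA hsst hordinary hv π q (hN ▸ dvd_mul_left q _) hLL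

end Summit.BirchSwinnertonDyer.BirchSwinnertonDyer.Theorems.KimAtThreeDeepLowerOffStratumLevelLoweringDoubleStabRows

end
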